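/-
Copyright: cell `pub-balaban-gaps` (G2), seat ne6 (row NE7b), `prover-pub-balaban-gaps-ne6-g15-0`. Released under the licence of the
surrounding project.
-/
import Summits.QuantumFields.BalabanUV.T4Continuum.Spine.NE7b.CompactFibreWindowSUN

/-!
# CENTRED WINDOWS AND THE SHIFTED INTERACTION LETTER FOR `SU(N) ⊂ U(N)`, ALL `N` (Hilbert–Schmidt distance): a Haar ball of `SU(N)` around ANY
# centre `U₀` has the mass of the ball around `1`, so every window-volume letter (`CompactFibreWindowSUN`, `…SUNRate`) holds for centred windows;
# and the Wilson plaquette EXCESS `β·Re tr(1 − U_p) − β·Re tr(1 − U⁰_p)` over a centre configuration is `≤ (β∕2)·4ρ·(2s + 4ρ)` per plaquette on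
# the `ρ`-window around it (row NE7b, node U5c; the all-`N` form of `CompactFibreWindowCentred`, which is the `SU(2) ↔ S³ ⊂ ℍ` model)

Cell `pub-balaban-gaps` (G2 spine census) for the `pub-balaban` T⁴ crux NE7b (`T4WeightBudget.RelWeightBound`; the cell's OWN estimate — NOT PRINTED in
[Bałaban 1983–89], NOT PROVED).  Crux-route work under `Spine/NE7b/`; NOTHING of Bałaban's is named or asserted; no `T4Continuum/Support` leaf typed; no
`def`; zero `sorry`.  Imports this seat's `CompactFibreWindowSUN` only (for the OWNER's `CompactFibreCarrier.pi_window_measure`, the tree's `UnitaryCayley`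
(`re_trace_one_sub`) and `YangMillsClassical` (`frobenius_norm_unitaryGroup_mul` ∕ `_mul_unitaryGroup`) through it).

WHY.  `CompactFibreWindowCentred` (this seat, gen 11) supplied, in the quaternion model of `SU(2)`, the two letters of the refuter's exit σ-ne7bref-g69-1 (a)
(PRICING-NE7b v76 F413 Parts G–H): (i) the Haar mass of a window does not depend on its centre (so the window may be centred at a background-dependent
configuration `U₀(y)` — print: the boundary-data minimiser of [Balaban1989LargeFieldI] (1.3)), (ii) the Wilson EXCESS over the centre is small on the
centred window, `≤ (β∕2)·4ρ·(2s + 4ρ)` per plaquette.  The headline is stated for `SU(N)`, every `N`; the letters are Hilbert–Schmidt-norm algebra on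
`U(N)` and hold verbatim for all `N`: left invariance of Haar measure and unitary invariance of `‖·‖_HS` for (i); `‖UV − U′V′‖ ≤ ‖U − U′‖ + ‖V − V′‖`,
`‖U⁻¹ − V⁻¹‖ = ‖U − V‖` and `Re tr(1 − U) = ½‖U − 1‖²_HS` (the tree's `UnitaryCayley.re_trace_one_sub`, Chatterjee's Lemma 7.2) for (ii).  THIS FILE types
them, so that the all-`N` letters of `CompactFibreWindowSUN` (rate `N²`) and `CompactFibreWindowSUNRate` (print's rate `N² − 1`) apply to CENTRED windows, and
`CompactFibreWindowSUN` §4's ABSOLUTE interaction letter (`8βε²` per plaquette around the identity — dead BY VALUE at print's window, κ-ne7bref-g69-1) is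
replaced by the RELATIVE one for every `N`.

WHAT IS PROVED ([folklore]):
* §1 CENTRED WINDOWS IN `SU(N)`: `norm_coe_inv_mul_sub_one` (`‖U₀⁻¹U − 1‖_HS = ‖U − U₀‖_HS`), `centredBall_eq_preimage`, **`haar_centredBall_eq`** (the Haar mass of
  `{‖U − U₀‖_HS ≤ ε}` equals that of `{‖U − 1‖_HS ≤ ε}`), `measurableSet_centredBall`; for a centre CONFIGURATION `U₀ : bonds → SU(N)`: `pi_centredBall_toReal_eq`,
  **`neg_log_pi_centredBall_le_of_letter`** (ANY per-bond letter `−log Haar(SB ε) ≤ b` gives `−log κ(Π_b B(U₀ b, ε)) ≤ #bonds·b`), **`abs_neg_log_pi_centredBall_sub_le_of_letter`**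
  (two-sided: `|−log Haar(SB ε) − d| ≤ c ⊢ |−log κ(Π_b B(U₀ b, ε)) − #bonds·d| ≤ #bonds·c` — with `CompactFibreWindowSUNRate`: `d = (N² − 1)·log ε⁻¹`), and BY VALUE
  today from `CompactFibreWindowSUN`: `exists_neg_log_pi_centredBall_le` (`≤ #bonds·(N²·log(2∕ε) − log C)`).
* §2 THE SHIFTED INTERACTION LETTER IN `U(N) ⊇ SU(N)`: `norm_mul_sub_mul_le` (`‖UV − U′V′‖ ≤ ‖U − U′‖ + ‖V − V′‖`), `norm_inv_sub_inv` (`‖U⁻¹ − V⁻¹‖ = ‖U − V‖`),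
  **`norm_word_sub_word_le`** (plaquette words: `‖U₁U₂U₃⁻¹U₄⁻¹ − V₁V₂V₃⁻¹V₄⁻¹‖ ≤ Σᵢ‖Uᵢ − Vᵢ‖`), `re_trace_one_sub_eq_half_norm_sq` (`Re tr(1 − U) = ½‖U − 1‖²`),
  **`abs_wilsonTerm_sub_le`** (`|β·Re tr(1 − U) − β·Re tr(1 − V)| ≤ (β∕2)·d·(2s + d)` when `‖U − V‖ ≤ d`, `‖V − 1‖ ≤ s`), **`abs_excess_le_of_centredWindow`**
  (`≤ (β∕2)·(4ρ)·(2s + 4ρ)` per plaquette), `excess_sum_le_of_centredWindow`, `excess_signed_sum_le_of_centredWindow` (the signed sum a relative display's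
  `I ≤ m(y) + i₀` consumes); `SU(N)` corollary `abs_excess_le_of_centredWindow_SUN`.

HONEST REMARKS.  That the creation-level numerator is carried by the POSITIVITY of the EXCESS over the boundary-data minimiser (print's (1.3)–(1.5)) and which
`ρ, s` enter are (A3) ∕ (A1c) readings — NOT asserted; the minimiser itself is not constructed here (any centre configuration `U₀` is allowed).  Nothing of
Bałaban's is asserted, valued or discharged.  NE7b NOT PRINTED ∕ NOT PROVED; spine PROVED 0∕9; rung (B)+1 on a FINITE torus — NOT infinite volume, NOT the
mass gap, NOT Clay.
HONEST DEPENDENCY: continuum YM on T⁴ ⇐ BetaPertH ∧ nine spine estimates (0/9 proved); BetaPertH ⇐ (D1) ∧ (D4) ∧ CAP+tail;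
G-an2-4 gates asym, D1 and NE2/3/4.  This file changes none of it.
-/

set_option autoImplicit false

open MeasureTheory Real Finset
open scoped Matrix.Norms.Frobenius
open Literature.MathematicalPhysics.QuantumFieldTheory (haarProbability)
open Literature.MathematicalPhysics.QuantumFieldTheory.UnitaryCayley (re_trace_one_sub)
open Summit.QuantumFields.BalabanUV.T4Continuum.NE7b.CompactFibreCarrier

namespace Summit.QuantumFields.BalabanUV.T4Continuum.NE7b.CompactFibreWindowCentredSUN

noncomputable section

variable {N : ℕ}

/-! ## §1 Centred windows in `SU(N)`: the Haar mass of a Hilbert–Schmidt ball does not depend on its centre -/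

/-- **TRANSLATION TO THE IDENTITY**: `‖U₀⁻¹U − 1‖_HS = ‖U − U₀‖_HS` (`U₀⁻¹U − 1 = U₀⁻¹(U − U₀)`, unitary invariance of the Hilbert–Schmidt norm). [folklore] -/
theorem norm_coe_inv_mul_sub_one (U₀ U : Matrix.specialUnitaryGroup (Fin N) ℂ) :
    ‖((U₀⁻¹ * U : Matrix.specialUnitaryGroup (Fin N) ℂ) : Matrix (Fin N) (Fin N) ℂ) - 1‖ = ‖(U : Matrix (Fin N) (Fin N) ℂ) - (U₀ : Matrix (Fin N) (Fin N) ℂ)‖ := by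
  have e0 : ((U₀⁻¹ : Matrix.specialUnitaryGroup (Fin N) ℂ) : Matrix (Fin N) (Fin N) ℂ) * (U₀ : Matrix (Fin N) (Fin N) ℂ) = 1 := by
    rw [← Submonoid.coe_mul, inv_mul_cancel]; rfl
  have e : ((U₀⁻¹ * U : Matrix.specialUnitaryGroup (Fin N) ℂ) : Matrix (Fin N) (Fin N) ℂ) - 1 =
      ((U₀⁻¹ : Matrix.specialUnitaryGroup (Fin N) ℂ) : Matrix (Fin N) (Fin N) ℂ) * ((U : Matrix (Fin N) (Fin N) ℂ) - (U₀ : Matrix (Fin N) (Fin N) ℂ)) := by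
    rw [Matrix.mul_sub, e0, Submonoid.coe_mul]
  rw [e]
  exact Matrix.frobenius_norm_unitaryGroup_mul ⟨_, (Matrix.mem_specialUnitaryGroup_iff.1 (U₀⁻¹).2).1⟩ _  -- (`SU(N) ⊂ U(N)`; the tree's `su_mem_unitaryGroup`)

/-- The centred ball is the preimage of the identity-centred ball under `U ↦ U₀⁻¹U`. [folklore] -/
theorem centredBall_eq_preimage (U₀ : Matrix.specialUnitaryGroup (Fin N) ℂ) (ε : ℝ) :
    {U : Matrix.specialUnitaryGroup (Fin N) ℂ | ‖(U : Matrix (Fin N) (Fin N) ℂ) - (U₀ : Matrix (Fin N) (Fin N) ℂ)‖ ≤ ε} =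
      (fun U : Matrix.specialUnitaryGroup (Fin N) ℂ => U₀⁻¹ * U) ⁻¹' {U : Matrix.specialUnitaryGroup (Fin N) ℂ | ‖(U : Matrix (Fin N) (Fin N) ℂ) - 1‖ ≤ ε} := by
  ext U
  simp only [Set.mem_setOf_eq, Set.mem_preimage, norm_coe_inv_mul_sub_one]

/-- **THE HAAR MASS OF A HILBERT–SCHMIDT BALL OF `SU(N)` DOES NOT DEPEND ON ITS CENTRE** (left invariance of the Haar probability). [folklore] -/
theorem haar_centredBall_eq (U₀ : Matrix.specialUnitaryGroup (Fin N) ℂ) (ε : ℝ) :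
    haarProbability (Matrix.specialUnitaryGroup (Fin N) ℂ) {U : Matrix.specialUnitaryGroup (Fin N) ℂ | ‖(U : Matrix (Fin N) (Fin N) ℂ) - (U₀ : Matrix (Fin N) (Fin N) ℂ)‖ ≤ ε} =
      haarProbability (Matrix.specialUnitaryGroup (Fin N) ℂ) {U : Matrix.specialUnitaryGroup (Fin N) ℂ | ‖(U : Matrix (Fin N) (Fin N) ℂ) - 1‖ ≤ ε} := by
  rw [centredBall_eq_preimage, measure_preimage_mul]

/-- The centred ball is measurable (closed). [folklore] -/
theorem measurableSet_centredBall (U₀ : Matrix.specialUnitaryGroup (Fin N) ℂ) (ε : ℝ) :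
    MeasurableSet {U : Matrix.specialUnitaryGroup (Fin N) ℂ | ‖(U : Matrix (Fin N) (Fin N) ℂ) - (U₀ : Matrix (Fin N) (Fin N) ℂ)‖ ≤ ε} := by
  have hc : Continuous fun U : (Matrix.specialUnitaryGroup (Fin N) ℂ) => ‖(U : Matrix (Fin N) (Fin N) ℂ) - (U₀ : Matrix (Fin N) (Fin N) ℂ)‖ :=
    (continuous_subtype_val.sub continuous_const).norm
  exact (isClosed_le hc continuous_const).measurableSet

section Region

variable {B : Type*} [Fintype B]

/-- For a centre CONFIGURATION `U₀ : bonds → SU(N)`: the product window's mass is the `#bonds`-th power of the identity-centred one-bond mass. [folklore] -/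
theorem pi_centredBall_toReal_eq (U₀ : B → Matrix.specialUnitaryGroup (Fin N) ℂ) (ε : ℝ) :
    ((Measure.pi fun _ : B => haarProbability (Matrix.specialUnitaryGroup (Fin N) ℂ))
        (Set.univ.pi fun b : B => {U : Matrix.specialUnitaryGroup (Fin N) ℂ | ‖(U : Matrix (Fin N) (Fin N) ℂ) - (U₀ b : Matrix (Fin N) (Fin N) ℂ)‖ ≤ ε})).toReal =
      ((haarProbability (Matrix.specialUnitaryGroup (Fin N) ℂ) {U : Matrix.specialUnitaryGroup (Fin N) ℂ | ‖(U : Matrix (Fin N) (Fin N) ℂ) - 1‖ ≤ ε}).toReal) ^ Fintype.card B := by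
  rw [pi_window_measure]
  simp_rw [haar_centredBall_eq]
  rw [Finset.prod_const, Finset.card_univ]

/-- **ANY PER-BOND LETTER MOVES TO THE CENTRE**: `Haar(SB ε) > 0` and `−log Haar(SB ε) ≤ b` (e.g. `CompactFibreWindowSUNRate.exists_neg_log_haar_sball_le_sharp`:
`b = (N² − 1)·log ε⁻¹ + c`) give, for every centre configuration, positive mass and `−log κ(Π_b B(U₀ b, ε)) ≤ #bonds·b`. [folklore] -/
theorem neg_log_pi_centredBall_le_of_letter {ε b : ℝ} (U₀ : B → Matrix.specialUnitaryGroup (Fin N) ℂ)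
    (hpos : 0 < (haarProbability (Matrix.specialUnitaryGroup (Fin N) ℂ) {U : Matrix.specialUnitaryGroup (Fin N) ℂ | ‖(U : Matrix (Fin N) (Fin N) ℂ) - 1‖ ≤ ε}).toReal)
    (hb : -Real.log (haarProbability (Matrix.specialUnitaryGroup (Fin N) ℂ) {U : Matrix.specialUnitaryGroup (Fin N) ℂ | ‖(U : Matrix (Fin N) (Fin N) ℂ) - 1‖ ≤ ε}).toReal ≤ b) :
    0 < ((Measure.pi fun _ : B => haarProbability (Matrix.specialUnitaryGroup (Fin N) ℂ))
        (Set.univ.pi fun b : B => {U : Matrix.specialUnitaryGroup (Fin N) ℂ | ‖(U : Matrix (Fin N) (Fin N) ℂ) - (U₀ b : Matrix (Fin N) (Fin N) ℂ)‖ ≤ ε})).toReal ∧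
      -Real.log ((Measure.pi fun _ : B => haarProbability (Matrix.specialUnitaryGroup (Fin N) ℂ))
        (Set.univ.pi fun b : B => {U : Matrix.specialUnitaryGroup (Fin N) ℂ | ‖(U : Matrix (Fin N) (Fin N) ℂ) - (U₀ b : Matrix (Fin N) (Fin N) ℂ)‖ ≤ ε})).toReal ≤ (Fintype.card B : ℝ) * b := by
  rw [pi_centredBall_toReal_eq, Real.log_pow, ← mul_neg]
  exact ⟨pow_pos hpos _, mul_le_mul_of_nonneg_left hb (Nat.cast_nonneg _)⟩

/-- **… ON BOTH SIDES**: a two-sided one-bond pin `|−log Haar(SB ε) − d| ≤ c` (e.g. `CompactFibreWindowSUNRate.exists_abs_neg_log_haar_sball_sub_le`: `d = (N² − 1)·log ε⁻¹`)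
gives `|−log κ(Π_b B(U₀ b, ε)) − #bonds·d| ≤ #bonds·c` for every centre configuration. [folklore] -/
theorem abs_neg_log_pi_centredBall_sub_le_of_letter {ε c d : ℝ} (U₀ : B → Matrix.specialUnitaryGroup (Fin N) ℂ)
    (habs : |-Real.log (haarProbability (Matrix.specialUnitaryGroup (Fin N) ℂ) {U : Matrix.specialUnitaryGroup (Fin N) ℂ | ‖(U : Matrix (Fin N) (Fin N) ℂ) - 1‖ ≤ ε}).toReal - d| ≤ c) :
    |-Real.log ((Measure.pi fun _ : B => haarProbability (Matrix.specialUnitaryGroup (Fin N) ℂ))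
        (Set.univ.pi fun b : B => {U : Matrix.specialUnitaryGroup (Fin N) ℂ | ‖(U : Matrix (Fin N) (Fin N) ℂ) - (U₀ b : Matrix (Fin N) (Fin N) ℂ)‖ ≤ ε})).toReal - (Fintype.card B : ℝ) * d|
      ≤ (Fintype.card B : ℝ) * c := by
  rw [pi_centredBall_toReal_eq, Real.log_pow,
    show ∀ x : ℝ, -((Fintype.card B : ℝ) * x) - (Fintype.card B : ℝ) * d = (Fintype.card B : ℝ) * (-x - d) from fun x => by ring, abs_mul, Nat.abs_cast]
  exact mul_le_mul_of_nonneg_left habs (Nat.cast_nonneg _)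

/-- **BY VALUE TODAY** (`CompactFibreWindowSUN.exists_neg_log_haar_sball_le`, exponent `N²`; `CompactFibreWindowSUNRate` lowers it to `N² − 1` by the same one line): there is `C > 0`
with, for all `0 < ε ≤ 2` and EVERY centre configuration `U₀`, positive mass and `−log κ(Π_b B(U₀ b, ε)) ≤ #bonds·(N²·log(2∕ε) − log C)`. [folklore] -/
theorem exists_neg_log_pi_centredBall_le :
    ∃ C : ℝ, 0 < C ∧ ∀ ε : ℝ, 0 < ε → ε ≤ 2 → ∀ U₀ : B → Matrix.specialUnitaryGroup (Fin N) ℂ,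
      0 < ((Measure.pi fun _ : B => haarProbability (Matrix.specialUnitaryGroup (Fin N) ℂ))
          (Set.univ.pi fun b : B => {U : Matrix.specialUnitaryGroup (Fin N) ℂ | ‖(U : Matrix (Fin N) (Fin N) ℂ) - (U₀ b : Matrix (Fin N) (Fin N) ℂ)‖ ≤ ε})).toReal ∧
        -Real.log ((Measure.pi fun _ : B => haarProbability (Matrix.specialUnitaryGroup (Fin N) ℂ))
          (Set.univ.pi fun b : B => {U : Matrix.specialUnitaryGroup (Fin N) ℂ | ‖(U : Matrix (Fin N) (Fin N) ℂ) - (U₀ b : Matrix (Fin N) (Fin N) ℂ)‖ ≤ ε})).toReal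
          ≤ (Fintype.card B : ℝ) * ((N * N : ℝ) * Real.log (2 / ε) - Real.log C) := by
  obtain ⟨C, hC, h⟩ := CompactFibreWindowSUN.exists_neg_log_haar_sball_le (N := N)
  refine ⟨C, hC, fun ε hε hε2 U₀ => ?_⟩
  obtain ⟨hreal, hlog⟩ := h ε hε hε2
  exact neg_log_pi_centredBall_le_of_letter U₀ (lt_of_lt_of_le (by positivity) hreal) hlog

end Region

/-! ## §2 The shifted interaction letter in `U(N) ⊇ SU(N)`: plaquette words are 1-Lipschitz in each bond, and the Wilson excess on a centred window -/

/-- Products of unitaries: `‖UV − U′V′‖ ≤ ‖U − U′‖ + ‖V − V′‖` (`UV − U′V′ = U(V − V′) + (U − U′)V′`, unitary invariance of `‖·‖_HS`). [folklore] -/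
theorem norm_mul_sub_mul_le (U V U' V' : Matrix.unitaryGroup (Fin N) ℂ) :
    ‖((U * V : Matrix.unitaryGroup (Fin N) ℂ) : Matrix (Fin N) (Fin N) ℂ) - ((U' * V' : Matrix.unitaryGroup (Fin N) ℂ) : Matrix (Fin N) (Fin N) ℂ)‖ ≤
      ‖(U : Matrix (Fin N) (Fin N) ℂ) - U'‖ + ‖(V : Matrix (Fin N) (Fin N) ℂ) - V'‖ := by
  have e : ((U * V : Matrix.unitaryGroup (Fin N) ℂ) : Matrix (Fin N) (Fin N) ℂ) - ((U' * V' : Matrix.unitaryGroup (Fin N) ℂ) : Matrix (Fin N) (Fin N) ℂ) =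
      (U : Matrix (Fin N) (Fin N) ℂ) * ((V : Matrix (Fin N) (Fin N) ℂ) - V') + ((U : Matrix (Fin N) (Fin N) ℂ) - U') * (V' : Matrix (Fin N) (Fin N) ℂ) := by
    rw [Submonoid.coe_mul, Submonoid.coe_mul, Matrix.mul_sub, Matrix.sub_mul]; abel
  rw [e]
  calc _ ≤ ‖(U : Matrix (Fin N) (Fin N) ℂ) * ((V : Matrix (Fin N) (Fin N) ℂ) - V')‖ + ‖((U : Matrix (Fin N) (Fin N) ℂ) - U') * (V' : Matrix (Fin N) (Fin N) ℂ)‖ := norm_add_le _ _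
    _ = ‖(V : Matrix (Fin N) (Fin N) ℂ) - V'‖ + ‖(U : Matrix (Fin N) (Fin N) ℂ) - U'‖ := by
        rw [Matrix.frobenius_norm_unitaryGroup_mul, Matrix.frobenius_norm_mul_unitaryGroup]
    _ = _ := add_comm _ _

/-- Inversion is an isometry: `‖U⁻¹ − V⁻¹‖ = ‖U − V‖` (`U⁻¹ − V⁻¹ = U⁻¹(V − U)V⁻¹`). [folklore] -/
theorem norm_inv_sub_inv (U V : Matrix.unitaryGroup (Fin N) ℂ) :
    ‖((U⁻¹ : Matrix.unitaryGroup (Fin N) ℂ) : Matrix (Fin N) (Fin N) ℂ) - ((V⁻¹ : Matrix.unitaryGroup (Fin N) ℂ) : Matrix (Fin N) (Fin N) ℂ)‖ = ‖(U : Matrix (Fin N) (Fin N) ℂ) - V‖ := by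
  have hU : ((U⁻¹ : Matrix.unitaryGroup (Fin N) ℂ) : Matrix (Fin N) (Fin N) ℂ) * (U : Matrix (Fin N) (Fin N) ℂ) = 1 := by
    rw [← Submonoid.coe_mul, inv_mul_cancel]; rfl
  have hV : (V : Matrix (Fin N) (Fin N) ℂ) * ((V⁻¹ : Matrix.unitaryGroup (Fin N) ℂ) : Matrix (Fin N) (Fin N) ℂ) = 1 := by
    rw [← Submonoid.coe_mul, mul_inv_cancel]; rfl
  have e : ((U⁻¹ : Matrix.unitaryGroup (Fin N) ℂ) : Matrix (Fin N) (Fin N) ℂ) - ((V⁻¹ : Matrix.unitaryGroup (Fin N) ℂ) : Matrix (Fin N) (Fin N) ℂ) =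
      ((U⁻¹ : Matrix.unitaryGroup (Fin N) ℂ) : Matrix (Fin N) (Fin N) ℂ) * ((V : Matrix (Fin N) (Fin N) ℂ) - U) * ((V⁻¹ : Matrix.unitaryGroup (Fin N) ℂ) : Matrix (Fin N) (Fin N) ℂ) := by
    rw [Matrix.mul_sub, Matrix.sub_mul, Matrix.mul_assoc, hV, Matrix.mul_one, hU, Matrix.one_mul]
  rw [e, Matrix.frobenius_norm_mul_unitaryGroup, Matrix.frobenius_norm_unitaryGroup_mul, norm_sub_rev]

/-- **PLAQUETTE WORDS ARE 1-LIPSCHITZ IN EACH BOND**: `‖U₁U₂U₃⁻¹U₄⁻¹ − V₁V₂V₃⁻¹V₄⁻¹‖ ≤ Σᵢ ‖Uᵢ − Vᵢ‖` (Hilbert–Schmidt, `U(N)`, all `N`). [folklore] -/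
theorem norm_word_sub_word_le (U₁ U₂ U₃ U₄ V₁ V₂ V₃ V₄ : Matrix.unitaryGroup (Fin N) ℂ) :
    ‖((U₁ * U₂ * U₃⁻¹ * U₄⁻¹ : Matrix.unitaryGroup (Fin N) ℂ) : Matrix (Fin N) (Fin N) ℂ) - ((V₁ * V₂ * V₃⁻¹ * V₄⁻¹ : Matrix.unitaryGroup (Fin N) ℂ) : Matrix (Fin N) (Fin N) ℂ)‖ ≤
      ‖(U₁ : Matrix (Fin N) (Fin N) ℂ) - V₁‖ + ‖(U₂ : Matrix (Fin N) (Fin N) ℂ) - V₂‖ + ‖(U₃ : Matrix (Fin N) (Fin N) ℂ) - V₃‖ + ‖(U₄ : Matrix (Fin N) (Fin N) ℂ) - V₄‖ := by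
  have h12 := norm_mul_sub_mul_le U₁ U₂ V₁ V₂
  have h123 := norm_mul_sub_mul_le (U₁ * U₂) U₃⁻¹ (V₁ * V₂) V₃⁻¹
  have h1234 := norm_mul_sub_mul_le (U₁ * U₂ * U₃⁻¹) U₄⁻¹ (V₁ * V₂ * V₃⁻¹) V₄⁻¹
  rw [norm_inv_sub_inv] at h123 h1234
  linarith

/-- **THE WILSON TERM IS HALF A SQUARED HILBERT–SCHMIDT DISTANCE** (the tree's Lemma 7.2 `re_trace_one_sub`): `Re tr(1 − U) = ½‖U − 1‖²` for `U ∈ U(N)`. [folklore] -/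
theorem re_trace_one_sub_eq_half_norm_sq (U : Matrix.unitaryGroup (Fin N) ℂ) :
    (Matrix.trace (1 - (U : Matrix (Fin N) (Fin N) ℂ))).re = (1 / 2 : ℝ) * ‖(U : Matrix (Fin N) (Fin N) ℂ) - 1‖ ^ 2 := by
  rw [re_trace_one_sub U.2, norm_sub_rev]; ring

/-- **THE EXCESS OF ONE WILSON TERM**: if `‖U − V‖ ≤ d` and the comparison matrix is small-field, `‖V − 1‖ ≤ s`, then `|β·Re tr(1 − U) − β·Re tr(1 − V)| ≤ (β∕2)·d·(2s + d)`
(`|a² − b²| = |a − b|(a + b)`, `|a − b| ≤ d`, `a + b ≤ 2s + d`). [folklore] -/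
theorem abs_wilsonTerm_sub_le {β d s : ℝ} (hβ : 0 ≤ β) (U V : Matrix.unitaryGroup (Fin N) ℂ) (hd : ‖(U : Matrix (Fin N) (Fin N) ℂ) - V‖ ≤ d) (hs : ‖(V : Matrix (Fin N) (Fin N) ℂ) - 1‖ ≤ s) :
    |β * (Matrix.trace (1 - (U : Matrix (Fin N) (Fin N) ℂ))).re - β * (Matrix.trace (1 - (V : Matrix (Fin N) (Fin N) ℂ))).re| ≤ β / 2 * d * (2 * s + d) := by
  rw [re_trace_one_sub_eq_half_norm_sq, re_trace_one_sub_eq_half_norm_sq]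
  set a := ‖(U : Matrix (Fin N) (Fin N) ℂ) - 1‖ with ha
  set b := ‖(V : Matrix (Fin N) (Fin N) ℂ) - 1‖ with hb
  have ha0 : 0 ≤ a := norm_nonneg _
  have hb0 : 0 ≤ b := norm_nonneg _
  have hab : |a - b| ≤ d := by
    calc |a - b| ≤ ‖((U : Matrix (Fin N) (Fin N) ℂ) - 1) - ((V : Matrix (Fin N) (Fin N) ℂ) - 1)‖ := abs_norm_sub_norm_le _ _
      _ = ‖(U : Matrix (Fin N) (Fin N) ℂ) - V‖ := by rw [sub_sub_sub_cancel_right]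
      _ ≤ d := hd
  have hd0 : 0 ≤ d := (abs_nonneg _).trans hab
  have hsum : a + b ≤ 2 * s + d := by
    have : a ≤ b + d := by linarith [(abs_le.1 hab).2]
    linarith
  have key : |a ^ 2 - b ^ 2| ≤ d * (2 * s + d) := by
    rw [sq_sub_sq, abs_mul, abs_of_nonneg (by linarith : 0 ≤ a + b), mul_comm]
    exact mul_le_mul hab hsum (by linarith) hd0
  rw [← mul_sub, ← mul_sub, abs_mul, abs_mul, abs_of_nonneg hβ, abs_of_nonneg (by norm_num : (0 : ℝ) ≤ 1 / 2)]
  nlinarith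

/-- **THE SHIFTED INTERACTION LETTER, ONE PLAQUETTE, ALL `N`**: four bonds within `ρ` of the centre's bonds and a small-field centre plaquette (`‖V₁V₂V₃⁻¹V₄⁻¹ − 1‖ ≤ s`) give an
excess `|β·Re tr(1 − U₁U₂U₃⁻¹U₄⁻¹) − β·Re tr(1 − V₁V₂V₃⁻¹V₄⁻¹)| ≤ (β∕2)·(4ρ)·(2s + 4ρ)`. [folklore] -/
theorem abs_excess_le_of_centredWindow {β ρ s : ℝ} (hβ : 0 ≤ β) (U₁ U₂ U₃ U₄ V₁ V₂ V₃ V₄ : Matrix.unitaryGroup (Fin N) ℂ)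
    (h₁ : ‖(U₁ : Matrix (Fin N) (Fin N) ℂ) - V₁‖ ≤ ρ) (h₂ : ‖(U₂ : Matrix (Fin N) (Fin N) ℂ) - V₂‖ ≤ ρ) (h₃ : ‖(U₃ : Matrix (Fin N) (Fin N) ℂ) - V₃‖ ≤ ρ) (h₄ : ‖(U₄ : Matrix (Fin N) (Fin N) ℂ) - V₄‖ ≤ ρ)
    (hs : ‖((V₁ * V₂ * V₃⁻¹ * V₄⁻¹ : Matrix.unitaryGroup (Fin N) ℂ) : Matrix (Fin N) (Fin N) ℂ) - 1‖ ≤ s) :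
    |β * (Matrix.trace (1 - ((U₁ * U₂ * U₃⁻¹ * U₄⁻¹ : Matrix.unitaryGroup (Fin N) ℂ) : Matrix (Fin N) (Fin N) ℂ))).re -
        β * (Matrix.trace (1 - ((V₁ * V₂ * V₃⁻¹ * V₄⁻¹ : Matrix.unitaryGroup (Fin N) ℂ) : Matrix (Fin N) (Fin N) ℂ))).re| ≤ β / 2 * (4 * ρ) * (2 * s + 4 * ρ) :=
  abs_wilsonTerm_sub_le hβ _ _ (by linarith [norm_word_sub_word_le U₁ U₂ U₃ U₄ V₁ V₂ V₃ V₄]) hs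

/-- **SUMMED OVER THE PLAQUETTES TOUCHING THE REGION**: bond maps `b₁ … b₄` (the configuration) and `c₁ … c₄` (the centre), each bond within `ρ` of its centre and each centre
plaquette `σ`-small-field: total absolute excess `≤ #s·((β∕2)·(4ρ)·(2σ + 4ρ))`. [folklore] -/
theorem excess_sum_le_of_centredWindow {P : Type*} (s : Finset P) {β ρ σ : ℝ} (hβ : 0 ≤ β) (b₁ b₂ b₃ b₄ c₁ c₂ c₃ c₄ : P → Matrix.unitaryGroup (Fin N) ℂ)
    (hρ : ∀ p ∈ s, ‖(b₁ p : Matrix (Fin N) (Fin N) ℂ) - c₁ p‖ ≤ ρ ∧ ‖(b₂ p : Matrix (Fin N) (Fin N) ℂ) - c₂ p‖ ≤ ρ ∧ ‖(b₃ p : Matrix (Fin N) (Fin N) ℂ) - c₃ p‖ ≤ ρ ∧ ‖(b₄ p : Matrix (Fin N) (Fin N) ℂ) - c₄ p‖ ≤ ρ)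
    (hσ : ∀ p ∈ s, ‖((c₁ p * c₂ p * (c₃ p)⁻¹ * (c₄ p)⁻¹ : Matrix.unitaryGroup (Fin N) ℂ) : Matrix (Fin N) (Fin N) ℂ) - 1‖ ≤ σ) :
    ∑ p ∈ s, |β * (Matrix.trace (1 - ((b₁ p * b₂ p * (b₃ p)⁻¹ * (b₄ p)⁻¹ : Matrix.unitaryGroup (Fin N) ℂ) : Matrix (Fin N) (Fin N) ℂ))).re -
        β * (Matrix.trace (1 - ((c₁ p * c₂ p * (c₃ p)⁻¹ * (c₄ p)⁻¹ : Matrix.unitaryGroup (Fin N) ℂ) : Matrix (Fin N) (Fin N) ℂ))).re|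
      ≤ (s.card : ℝ) * (β / 2 * (4 * ρ) * (2 * σ + 4 * ρ)) := by
  have key : ∀ p ∈ s, |β * (Matrix.trace (1 - ((b₁ p * b₂ p * (b₃ p)⁻¹ * (b₄ p)⁻¹ : Matrix.unitaryGroup (Fin N) ℂ) : Matrix (Fin N) (Fin N) ℂ))).re -
        β * (Matrix.trace (1 - ((c₁ p * c₂ p * (c₃ p)⁻¹ * (c₄ p)⁻¹ : Matrix.unitaryGroup (Fin N) ℂ) : Matrix (Fin N) (Fin N) ℂ))).re| ≤ β / 2 * (4 * ρ) * (2 * σ + 4 * ρ) :=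
    fun p hp => abs_excess_le_of_centredWindow hβ _ _ _ _ _ _ _ _ (hρ p hp).1 (hρ p hp).2.1 (hρ p hp).2.2.1 (hρ p hp).2.2.2 (hσ p hp)
  calc _ ≤ ∑ _p ∈ s, β / 2 * (4 * ρ) * (2 * σ + 4 * ρ) := Finset.sum_le_sum key
    _ = (s.card : ℝ) * (β / 2 * (4 * ρ) * (2 * σ + 4 * ρ)) := by rw [Finset.sum_const, nsmul_eq_mul]

/-- The SIGNED form a relative display consumes (`I ≤ m(y) + i₀` with `m(y)` the centre's action): `Σ_p (β·Re tr(1 − U_p) − β·Re tr(1 − U⁰_p)) ≤ #s·((β∕2)(4ρ)(2σ + 4ρ))`. [folklore] -/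
theorem excess_signed_sum_le_of_centredWindow {P : Type*} (s : Finset P) {β ρ σ : ℝ} (hβ : 0 ≤ β) (b₁ b₂ b₃ b₄ c₁ c₂ c₃ c₄ : P → Matrix.unitaryGroup (Fin N) ℂ)
    (hρ : ∀ p ∈ s, ‖(b₁ p : Matrix (Fin N) (Fin N) ℂ) - c₁ p‖ ≤ ρ ∧ ‖(b₂ p : Matrix (Fin N) (Fin N) ℂ) - c₂ p‖ ≤ ρ ∧ ‖(b₃ p : Matrix (Fin N) (Fin N) ℂ) - c₃ p‖ ≤ ρ ∧ ‖(b₄ p : Matrix (Fin N) (Fin N) ℂ) - c₄ p‖ ≤ ρ)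
    (hσ : ∀ p ∈ s, ‖((c₁ p * c₂ p * (c₃ p)⁻¹ * (c₄ p)⁻¹ : Matrix.unitaryGroup (Fin N) ℂ) : Matrix (Fin N) (Fin N) ℂ) - 1‖ ≤ σ) :
    ∑ p ∈ s, (β * (Matrix.trace (1 - ((b₁ p * b₂ p * (b₃ p)⁻¹ * (b₄ p)⁻¹ : Matrix.unitaryGroup (Fin N) ℂ) : Matrix (Fin N) (Fin N) ℂ))).re -
        β * (Matrix.trace (1 - ((c₁ p * c₂ p * (c₃ p)⁻¹ * (c₄ p)⁻¹ : Matrix.unitaryGroup (Fin N) ℂ) : Matrix (Fin N) (Fin N) ℂ))).re)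
      ≤ (s.card : ℝ) * (β / 2 * (4 * ρ) * (2 * σ + 4 * ρ)) :=
  (Finset.sum_le_sum fun _ _ => le_abs_self _).trans (excess_sum_le_of_centredWindow s hβ b₁ b₂ b₃ b₄ c₁ c₂ c₃ c₄ hρ hσ)

/-- **`SU(N)` COROLLARY** (the headline's group; words formed in `SU(N)`, distances on the matrices): the one-plaquette excess bound for `Uᵢ, Vᵢ ∈ SU(N)`. [folklore] -/
theorem abs_excess_le_of_centredWindow_SUN {β ρ s : ℝ} (hβ : 0 ≤ β) (U₁ U₂ U₃ U₄ V₁ V₂ V₃ V₄ : Matrix.specialUnitaryGroup (Fin N) ℂ)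
    (h₁ : ‖(U₁ : Matrix (Fin N) (Fin N) ℂ) - V₁‖ ≤ ρ) (h₂ : ‖(U₂ : Matrix (Fin N) (Fin N) ℂ) - V₂‖ ≤ ρ) (h₃ : ‖(U₃ : Matrix (Fin N) (Fin N) ℂ) - V₃‖ ≤ ρ) (h₄ : ‖(U₄ : Matrix (Fin N) (Fin N) ℂ) - V₄‖ ≤ ρ)
    (hs : ‖((V₁ * V₂ * V₃⁻¹ * V₄⁻¹ : Matrix.specialUnitaryGroup (Fin N) ℂ) : Matrix (Fin N) (Fin N) ℂ) - 1‖ ≤ s) :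
    |β * (Matrix.trace (1 - ((U₁ * U₂ * U₃⁻¹ * U₄⁻¹ : Matrix.specialUnitaryGroup (Fin N) ℂ) : Matrix (Fin N) (Fin N) ℂ))).re -
        β * (Matrix.trace (1 - ((V₁ * V₂ * V₃⁻¹ * V₄⁻¹ : Matrix.specialUnitaryGroup (Fin N) ℂ) : Matrix (Fin N) (Fin N) ℂ))).re| ≤ β / 2 * (4 * ρ) * (2 * s + 4 * ρ) := by
  set ι := Submonoid.inclusion (Matrix.specialUnitaryGroup_le_unitaryGroup (n := Fin N) (α := ℂ)) with hι
  have hwU : ((U₁ * U₂ * U₃⁻¹ * U₄⁻¹ : Matrix.specialUnitaryGroup (Fin N) ℂ) : Matrix (Fin N) (Fin N) ℂ) = ((ι U₁ * ι U₂ * (ι U₃)⁻¹ * (ι U₄)⁻¹ : Matrix.unitaryGroup (Fin N) ℂ) : Matrix (Fin N) (Fin N) ℂ) := by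
    rw [← map_inv, ← map_inv, ← map_mul, ← map_mul, ← map_mul]; rfl
  have hwV : ((V₁ * V₂ * V₃⁻¹ * V₄⁻¹ : Matrix.specialUnitaryGroup (Fin N) ℂ) : Matrix (Fin N) (Fin N) ℂ) = ((ι V₁ * ι V₂ * (ι V₃)⁻¹ * (ι V₄)⁻¹ : Matrix.unitaryGroup (Fin N) ℂ) : Matrix (Fin N) (Fin N) ℂ) := by
    rw [← map_inv, ← map_inv, ← map_mul, ← map_mul, ← map_mul]; rfl
  have h := abs_excess_le_of_centredWindow (ρ := ρ) (s := s) hβ (ι U₁) (ι U₂) (ι U₃) (ι U₄) (ι V₁) (ι V₂) (ι V₃) (ι V₄) h₁ h₂ h₃ h₄ (by rw [← hwV]; exact hs)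
  rw [← hwU, ← hwV] at h
  exact h

/-! ## §3 Sanity -/

/-- The excess letter vanishes at `ρ = 0` (the configuration IS the centre). -/
example {β s : ℝ} : β / 2 * (4 * (0 : ℝ)) * (2 * s + 4 * 0) = 0 := by ring

end

end Summit.QuantumFields.BalabanUV.T4Continuum.NE7b.CompactFibreWindowCentredSUN
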